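import Summits.HubbardSuperconductivity.HubbardSuperconductivity.Theorems.AnisotropyChordTransferFibre3KT2aRow
import Summits.HubbardSuperconductivity.HubbardSuperconductivity.Theorems.AnisotropyChordTransferFibre3N1RowReductions
import Summits.HubbardSuperconductivity.HubbardSuperconductivity.Theorems.AnisotropyChordTransferFibre3TwoHoleBSCovariance
import Summits.HubbardSuperconductivity.HubbardSuperconductivity.Theorems.AnisotropyChordTransferFibre3RowCPsi

/-!
# Route `AnisotropyChord` / H0 rotor rung: PartN41-D §4 — `EprimSymmetries` PROVED (symmetries of the trig-weighted propagator primitive)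

Theory-1 g22's PartN41-D §4 `EprimSymmetries` (port …Fibre3KT2aRow): for `E(r; S) = (1/V)Σ_p e^{−ip·r} Π_{s∈S} g(p + s)`:
translation of the shifts `E(r; S + t) = e^{it·r}E(r; S)` (reindex `p ↦ p − t`), joint inversion `E(−r; −S) = E(r; S)` (`g` even),
conjugation `conj E(r; S) = E(−r; S)` (`g` real), and covariance under the coordinate swap and the mirror (`g`, the phases are
point-group invariant: `gres_swap`, `TwoHoleBS.epsT_mirror`, `phase_swap_swap`, `RowC.phase_mirror_left`).
★ `eprimSymmetries_holds : EprimSymmetries L`.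
Prover seat `hubbard-h0-rotor-p1` g27 (route lead); helper for stmt-HubbardSuperconductivity-23918 (`--supports`, helper class).
WHAT THIS IS NOT: nothing here proves superconductivity in the Hubbard model.  Tree imports only; no new definitions; no sorry.
-/

set_option linter.dupNamespace false
set_option autoImplicit false

noncomputable section

open scoped BigOperators

namespace Summit.HubbardSuperconductivity.HubbardSuperconductivity.Theorems.AnisotropyChord.Transfer.Fibre3

variable (L : ℕ) [NeZero L]

namespace RowD

omit [NeZero L] in
/-- the product over a mapped shift list. [folklore] -/
theorem prod_map_map (lam2 : ℝ) (S : List (Tor L)) (φ : Tor L → Tor L) (p : Tor L) :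
    ((S.map φ).map (fun s => ((gres L lam2 (p + s) : ℝ) : ℂ))).prod
      = (S.map (fun s => ((gres L lam2 (p + φ s) : ℝ) : ℂ))).prod := by
  rw [List.map_map]; rfl

omit [NeZero L] in
/-- pointwise equal factors give equal products. [folklore] -/
theorem prod_congr (S : List (Tor L)) (F G : Tor L → ℂ) (h : ∀ s, F s = G s) :
    (S.map F).prod = (S.map G).prod := by
  rw [show F = G from funext h]

/-- `g(−k₁, k₂) = g(k)`. [folklore] -/
theorem gres_mirror (lam2 : ℝ) (k : Tor L) : gres L lam2 (-k.1, k.2) = gres L lam2 k := by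
  unfold gres
  have h1 : ((-k.1, k.2) : Tor L) = 0 ↔ k = 0 := RowC.mirror_eq_zero_iff L k
  by_cases hk : k = 0
  · rw [if_pos hk, if_pos (h1.mpr hk)]
  · rw [if_neg hk, if_neg (fun h => hk (h1.mp h)), TwoHoleBS.epsT_mirror]

/-- (1) translation of the shifts. [folklore] -/
theorem eprim_translate (lam2 : ℝ) (r t : Tor L) (S : List (Tor L)) :
    Eprim L lam2 r (S.map (fun s => s + t)) = phase L t r * Eprim L lam2 r S := by
  unfold Eprim
  rw [mul_div_assoc']
  congr 1
  rw [Finset.mul_sum]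
  simp_rw [prod_map_map]
  -- reindex `p ↦ p + t`
  refine Fintype.sum_equiv (Equiv.addRight t) _ _ (fun p => ?_)
  rw [Equiv.coe_addRight]
  have hph : phase L t r * (starRingEnd ℂ) (phase L (p + t) r) = (starRingEnd ℂ) (phase L p r) := by
    rw [phase_add_left, map_mul, conj_phase L t r, show phase L t r * ((starRingEnd ℂ) (phase L p r) * phase L t (-r))
      = (phase L t r * phase L t (-r)) * (starRingEnd ℂ) (phase L p r) by ring, phase_mul_neg, one_mul]
  rw [← mul_assoc, hph]
  congr 1
  exact prod_congr L S _ _ (fun s => by rw [show p + (s + t) = p + t + s by abel])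

/-- (2) joint inversion. [folklore] -/
theorem eprim_neg (lam2 : ℝ) (r : Tor L) (S : List (Tor L)) :
    Eprim L lam2 (-r) (S.map (fun s => -s)) = Eprim L lam2 r S := by
  unfold Eprim
  congr 1
  simp_rw [prod_map_map]
  refine Fintype.sum_equiv (Equiv.neg (Tor L)) _ _ (fun p => ?_)
  rw [Equiv.neg_apply]
  have hph : (starRingEnd ℂ) (phase L p (-r)) = (starRingEnd ℂ) (phase L (-p) r) := by
    rw [phase_neg_left]
  rw [hph]
  congr 1
  exact prod_congr L S _ _ (fun s => by rw [show p + -s = -(-p + s) by abel, B1.gres_neg])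

/-- (3) conjugation flips `r`. [folklore] -/
theorem eprim_conj (lam2 : ℝ) (r : Tor L) (S : List (Tor L)) :
    (starRingEnd ℂ) (Eprim L lam2 r S) = Eprim L lam2 (-r) S := by
  unfold Eprim
  rw [map_div₀, map_pow, map_natCast, map_sum]
  congr 1
  refine Finset.sum_congr rfl fun p _ => ?_
  rw [map_mul, Complex.conj_conj, conj_phase, neg_neg, map_list_prod, List.map_map]
  congr 1
  exact prod_congr L S _ _ (fun s => Complex.conj_ofReal _)

/-- (4) the coordinate swap. [folklore] -/
theorem eprim_swap (lam2 : ℝ) (r : Tor L) (S : List (Tor L)) :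
    Eprim L lam2 (r.2, r.1) (S.map (fun s => (s.2, s.1))) = Eprim L lam2 r S := by
  unfold Eprim
  congr 1
  simp_rw [prod_map_map]
  refine Fintype.sum_equiv (Equiv.prodComm (ZMod L) (ZMod L)) _ _ (fun p => ?_)
  rw [Equiv.prodComm_apply, Prod.swap]
  have hph : phase L p (r.2, r.1) = phase L (p.2, p.1) r := by
    have := phase_swap_swap L (p.2, p.1) r
    simpa using this
  rw [hph]
  congr 1
  refine prod_congr L S _ _ (fun s => ?_)
  have : (p + ((s.2, s.1) : Tor L)) = (((p.2, p.1) + s).2, ((p.2, p.1) + s).1) := by ext <;> simp [add_comm]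
  rw [this, gres_swap]

/-- (5) the mirror. [folklore] -/
theorem eprim_mirror (lam2 : ℝ) (r : Tor L) (S : List (Tor L)) :
    Eprim L lam2 (-r.1, r.2) (S.map (fun s => (-s.1, s.2))) = Eprim L lam2 r S := by
  unfold Eprim
  congr 1
  simp_rw [prod_map_map]
  refine Fintype.sum_equiv ⟨fun a => (-a.1, a.2), fun a => (-a.1, a.2), fun a => by simp, fun a => by simp⟩ _ _
    (fun p => ?_)
  show (starRingEnd ℂ) (phase L p (-r.1, r.2)) * (S.map (fun s => ((gres L lam2 (p + (-s.1, s.2)) : ℝ) : ℂ))).prod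
    = (starRingEnd ℂ) (phase L (-p.1, p.2) r) * (S.map (fun s => ((gres L lam2 ((-p.1, p.2) + s) : ℝ) : ℂ))).prod
  rw [RowC.phase_mirror_left]
  congr 1
  refine prod_congr L S _ _ (fun s => ?_)
  have : (p + ((-s.1, s.2) : Tor L)) = (-((-p.1, p.2) + s).1, ((-p.1, p.2) + s).2) := by ext <;> simp; ring
  rw [this, gres_mirror]

end RowD

/-- ★ **`EprimSymmetries L` holds.** [folklore] -/
theorem eprimSymmetries_holds : EprimSymmetries L := by
  intro lam2 r t S
  exact ⟨RowD.eprim_translate L lam2 r t S, RowD.eprim_neg L lam2 r S, RowD.eprim_conj L lam2 r S,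
    RowD.eprim_swap L lam2 r S, RowD.eprim_mirror L lam2 r S⟩

end Summit.HubbardSuperconductivity.HubbardSuperconductivity.Theorems.AnisotropyChord.Transfer.Fibre3

end
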